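import Summits.BirchSwinnertonDyer.Rank1Residual.F1Sign2.CasselsTateRadicalAtTwo
import Literature.NumberTheory.EllipticCurves.IsogenyQuadraticTwistProofs
import HarnessLib

/-!
# Route `GenusKolyvaginAtTwo`, crux #2 `GenusPrimitiveSupplyAtTwo` (stmt-BirchSwinnertonDyer-22136):
# the SUPPORT row `F1Sign2.QuadraticCharacterExists` — every `d ∈ ℤ` has a continuous quadratic character `χ_d : Γ_ℚ → {±1}`

Width seat `bsd-line-gk2-p4` g15 (cell `bsd-f1-sign2`). THEOREMS ONLY (no definition, no named fact, no `sorry`); helper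
`--supports stmt-BirchSwinnertonDyer-22136`; no item is closed; BSD is not proved by any of this.

WHY. Every row of the cell's `-desc` / `-an` twist packets (`F1Sign2/CasselsTateRadicalAtTwo.lean`, `…/TwistSelmerRelaxedAtInfinityAtTwo.lean`,
`…/TwoTranspositionDoorAtTwo.lean`: T-2q `TwoTranspositionTwistLawAtTwo`, DESC-§17-R, U′, …) quantifies over a character `χ` with
`IsQuadraticCharacterOf χ d`; to INSTANTIATE such a row at a given `d` (e.g. T-2q, now the tree theorem
`GenusKolyTransp.twoTranspositionTwistLawAtTwo_holds`, at the field of AN-26S) one needs the existence of `χ_d`, typed by `-ty` as the support row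
`QuadraticCharacterExists` («Kummer theory; routine»). This file proves it: **`quadraticCharacterExists_holds : QuadraticCharacterExists`**.

HOW (Kummer theory for `μ₂ ⊂ ℚ`). Fix `r₀ = √d ∈ ℚ̄` (`geomSqrt`). Every `σ ∈ Γ_ℚ` has `σ r₀ = ± r₀` (`(σ r₀)² = d`); `χ_d(σ) := [σ r₀ ≠ r₀] ∈ ℤ/2`
is multiplicative (`quadraticCharacterFun_mul`), its kernel is the stabiliser of `r₀`, which contains the open subgroup `Gal(ℚ̄/ℚ(r₀))`
(`IntermediateField.fixingSubgroup_isOpen`), so `χ_d` is continuous (an open subgroup is closed; `continuous_discrete_rng`); and for every square root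
`r = ± r₀` of `d`, `σ r = r ↔ σ r₀ = r₀`. For `d = 0` (`r₀ = 0`) and `d ∈ ℚ^{×2}` the character is trivial, as the row's docstring says.

References: [SerreGaloisCohomology1997] I §1.2 (continuous characters of profinite groups); [MazurRubin2007] §3 (the character of `K(√d)/K`).
-/

set_option linter.dupNamespace false -- tree convention: `Summit.BirchSwinnertonDyer.BirchSwinnertonDyer.Theorems` (summit = sub-problem)
set_option autoImplicit false

noncomputable section

open scoped Classical

namespace Summit.BirchSwinnertonDyer.BirchSwinnertonDyer.Theorems.GenusKolyTransp

open WeierstrassCurve Field Literature.NumberTheory.EllipticCurves Literature.NumberTheory.GaloisRepresentations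
open Summit.BirchSwinnertonDyer.Rank1Residual.F1Sign2

/-! ## §42 The sign of `σ` on a square root -/

/-- `σ ∈ Γ_ℚ` maps a square root `r` of a rational number to `± r`. [folklore] -/
theorem smul_eq_or_eq_neg_of_sq_eq (σ : absoluteGaloisGroup ℚ) {r : AlgebraicClosure ℚ} {d : ℚ}
    (hr : r ^ 2 = (d : AlgebraicClosure ℚ)) : σ • r = r ∨ σ • r = -r := by
  have h : (σ • r) ^ 2 = r ^ 2 := by
    rw [← smul_pow', hr, absoluteGaloisGroup.smul_def, map_ratCast]
  exact sq_eq_sq_iff_eq_or_eq_neg.mp h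

/-- If `σ` flips a non-zero `r` then it does not fix it. [folklore] -/
private theorem ne_of_smul_eq_neg {σ : absoluteGaloisGroup ℚ} {r : AlgebraicClosure ℚ} (hr0 : r ≠ 0) (h : σ • r = -r) : σ • r ≠ r := by
  intro h'
  rw [h'] at h
  have h2 : (2 : AlgebraicClosure ℚ) * r = 0 := by linear_combination h
  rcases mul_eq_zero.mp h2 with h2 | h2
  · exact two_ne_zero h2
  · exact hr0 h2

/-! ## §43 `QuadraticCharacterExists` -/

/-- **`F1Sign2.QuadraticCharacterExists` HOLDS**: every `d ∈ ℤ` has a continuous quadratic character `χ : Γ_ℚ →ₜ* {±1}` with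
`IsQuadraticCharacterOf χ d` (`χ σ = 1 ↔ σ` fixes the square roots of `d`). See the module docstring for the construction (`χ(σ) = [σ√d ≠ √d]`;
multiplicative because `Γ_ℚ` acts on `{±√d}`; continuous because the stabiliser of `√d` is an open subgroup).
[cite: SerreGaloisCohomology1997, I §1.2] [cite: MazurRubin2007, §3] -/
theorem quadraticCharacterExists_holds : QuadraticCharacterExists := by
  intro d
  -- the chosen square root `r₀` of `d`
  obtain ⟨r₀, hr₀⟩ : ∃ r₀ : AlgebraicClosure ℚ, r₀ ^ 2 = ((d : ℚ) : AlgebraicClosure ℚ) :=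
    ⟨geomSqrt (d : ℚ), by rw [geomSqrt_sq, eq_ratCast]⟩
  -- the function `χ(σ) = [σ r₀ ≠ r₀]`
  obtain ⟨f, hf⟩ : ∃ f : absoluteGaloisGroup ℚ → Multiplicative (ZMod 2),
      ∀ σ, f σ = if σ • r₀ = r₀ then 1 else Multiplicative.ofAdd 1 := ⟨_, fun _ ↦ rfl⟩
  have hf1 : ∀ σ, σ • r₀ = r₀ → f σ = 1 := fun σ h ↦ by rw [hf, if_pos h]
  have hfne : ∀ σ, σ • r₀ ≠ r₀ → f σ = Multiplicative.ofAdd 1 := fun σ h ↦ by rw [hf, if_neg h]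
  have hff : Multiplicative.ofAdd (1 : ZMod 2) * Multiplicative.ofAdd (1 : ZMod 2) = 1 := by decide
  have hne1 : Multiplicative.ofAdd (1 : ZMod 2) ≠ 1 := by decide
  -- multiplicativity
  have hmul : ∀ σ τ, f (σ * τ) = f σ * f τ := by
    intro σ τ
    by_cases hr00 : r₀ = 0
    · have hall : ∀ γ : absoluteGaloisGroup ℚ, γ • r₀ = r₀ := fun γ ↦ by rw [hr00, smul_zero]
      rw [hf1 _ (hall _), hf1 _ (hall _), hf1 _ (hall _), one_mul]
    rcases smul_eq_or_eq_neg_of_sq_eq τ hr₀ with hτ | hτ <;> rcases smul_eq_or_eq_neg_of_sq_eq σ hr₀ with hσ | hσ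
    · rw [hf1 τ hτ, hf1 σ hσ, hf1 _ (by rw [mul_smul, hτ, hσ]), one_mul]
    · rw [hf1 τ hτ, hfne σ (ne_of_smul_eq_neg hr00 hσ), hfne _ (ne_of_smul_eq_neg hr00 (by rw [mul_smul, hτ, hσ])), mul_one]
    · rw [hfne τ (ne_of_smul_eq_neg hr00 hτ), hf1 σ hσ, hfne _ (ne_of_smul_eq_neg hr00 (by rw [mul_smul, hτ, smul_neg, hσ])),
        one_mul]
    · rw [hfne τ (ne_of_smul_eq_neg hr00 hτ), hfne σ (ne_of_smul_eq_neg hr00 hσ), hff,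
        hf1 _ (by rw [mul_smul, hτ, smul_neg, hσ, neg_neg])]
  have hone : f 1 = 1 := hf1 1 (one_smul _ _)
  -- the stabiliser of `r₀` is open
  have hopen : IsOpen {σ : absoluteGaloisGroup ℚ | σ • r₀ = r₀} := by
    haveI : FiniteDimensional ℚ (IntermediateField.adjoin ℚ {r₀}) :=
      IntermediateField.adjoin.finiteDimensional ((AlgebraicClosure.isAlgebraic ℚ).isAlgebraic r₀).isIntegral
    have hst : IsOpen ((MulAction.stabilizer (absoluteGaloisGroup ℚ) r₀ : Subgroup (absoluteGaloisGroup ℚ)) :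
        Set (absoluteGaloisGroup ℚ)) := by
      refine Subgroup.isOpen_mono (H₁ := (IntermediateField.adjoin ℚ {r₀}).fixingSubgroup) ?_
        (IntermediateField.fixingSubgroup_isOpen _)
      intro σ hσ
      rw [IntermediateField.mem_fixingSubgroup_iff] at hσ
      exact hσ r₀ (IntermediateField.mem_adjoin_simple_self ℚ r₀)
    exact hst
  -- continuity: fibres are the (open) stabiliser and its (open) complement
  have hcont : Continuous f := by
    rw [continuous_discrete_rng]
    intro b
    by_cases hb : b = 1
    · subst hb
      have hpre : f ⁻¹' {1} = {σ : absoluteGaloisGroup ℚ | σ • r₀ = r₀} := by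
        ext σ
        simp only [Set.mem_preimage, Set.mem_singleton_iff, Set.mem_setOf_eq]
        exact ⟨fun h ↦ by_contra fun hσ ↦ hne1 ((hfne σ hσ).symm.trans h), hf1 σ⟩
      rw [hpre]; exact hopen
    · have hb' : b = Multiplicative.ofAdd 1 := by
        revert b; decide
      subst hb'
      have hpre : f ⁻¹' {Multiplicative.ofAdd 1} = {σ : absoluteGaloisGroup ℚ | σ • r₀ = r₀}ᶜ := by
        ext σ
        simp only [Set.mem_preimage, Set.mem_singleton_iff, Set.mem_compl_iff, Set.mem_setOf_eq]
        exact ⟨fun h hσ ↦ hne1 ((hf1 σ hσ).symm.trans h).symm, hfne σ⟩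
      rw [hpre, isOpen_compl_iff]
      -- an open subgroup is closed
      have hcl : IsClosed ((MulAction.stabilizer (absoluteGaloisGroup ℚ) r₀ : Subgroup (absoluteGaloisGroup ℚ)) :
          Set (absoluteGaloisGroup ℚ)) := Subgroup.isClosed_of_isOpen _ hopen
      exact hcl
  -- the character
  refine ⟨{ toFun := f, map_one' := hone, map_mul' := hmul, continuous_toFun := hcont }, fun r hr σ ↦ ?_⟩
  change f σ = 1 ↔ σ • r = r
  -- `r = ± r₀`
  have hrr : r = r₀ ∨ r = -r₀ := sq_eq_sq_iff_eq_or_eq_neg.mp (hr.trans hr₀.symm)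
  have key : f σ = 1 ↔ σ • r₀ = r₀ :=
    ⟨fun h ↦ by_contra fun hσ ↦ hne1 ((hfne σ hσ).symm.trans h), hf1 σ⟩
  rw [key]
  rcases hrr with rfl | rfl
  · exact Iff.rfl
  · rw [smul_neg, neg_inj]

end Summit.BirchSwinnertonDyer.BirchSwinnertonDyer.Theorems.GenusKolyTransp

end
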